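import Summits.BirchSwinnertonDyer.BirchSwinnertonDyer.Theorems.PublishedInputsGreenbergLemma34FormalKummer
import Summits.BirchSwinnertonDyer.BirchSwinnertonDyer.Theorems.PublishedInputsGreenbergLemma34HTwoCount
import Summits.BirchSwinnertonDyer.Rank1Residual.GaloisImage.LocalEulerPoincareCharacteristicHolds
import HarnessLib

set_option linter.dupNamespace false -- `…BirchSwinnertonDyer.BirchSwinnertonDyer…` is the cell's nested layout (D-0017)
set_option autoImplicit false

/-!
# Greenberg LNM 1716 Lemma 3.4 at `n = 0`, step 4: the EXACT formal-group count over `ℚ` at `v ∣ p`,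
# `#(Ê(𝔪̄)^{H_∞}/(g − 1))[p^k] = #(Ê[p^k])^τ` (Kummer EXACT + Tate's Euler–Poincaré formula + Lutz + the exact `H²` count)

Seat `bsd-inputs-k4-p1` (gen 5; LADDER-BSD D-0154 KEY (147)(f) «prove the printed input», row 1 K4 INPUTS; Greenberg
1999), `--supports stmt-BirchSwinnertonDyer-20309`. THEOREMS ONLY (no definition, no named fact, no `sorry`).

R. Greenberg, *Iwasawa theory for elliptic curves*, LNM 1716 (1999), §2 Prop. 2.5 (p. 80): `Im λ_η / Im κ_η ≅ Ẽ(m_η)_p`;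
equivalently `#H¹(F_v, 𝓕(𝔪̄)) = #Ẽ(f)_p`, the factor `|ker(a_v)|` of Lemma 3.4 (p. 89). Cell bsd-2adic's BRICK chain
(`GoodOrdTower.natCard_torsionBy_coinv_formal_le_of_localEP`, layer `n`, depth `p^k`) is the INEQUALITY
`#(M₁/D₁M₁)[p^k] ≤ #SF`. At the layer `0` every link is now an equality: Kummer EXACT
(`natCard_torsionBy_coinv_mul_card_quotient_eq_card_H1`, from Coates–Greenberg), Tate's local Euler–Poincaré formula
(`Rank1Residual.GaloisImage.localEulerPoincare`, PROVED in the tree), Lutz at depth `p^k`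
(`natCard_quotient_nsmul_fixedKernel_eq`, `natCard_quotient_nsmul_pow_eq`), and the exact `H²` count
(`natCard_H2_formalTorsion_eq_natCard_fixed`): the factors `p^k · #Ê(ℚ_v)[p^k]` cancel and

* `natCard_torsionBy_coinv_formal_eq` — in the abstract `red₀`-currency of the bsd-2adic bricks at `n = 0` over `ℚ`,
  `v ∣ p`, with a local `ℤ_p`-extension `κE` (kernel `H_∞`, topological generator `g`), the Coates–Greenberg vanishing in
  cocycle form (`hCG`) and the Hensel property (`hHensel`): **`#(M₁/D₁M₁)[p^k] = #{c ∈ Ê[p^k] : τ c = c}`** for every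
  `k` (and the left side is finite), `τ ∈ H_∞` a Frobenius fixing `μ_{p^∞}`.

HONEST FRAMING: a local TOOL theorem with displayed hypotheses; closes nothing; no summit statement is proved; BSD is
not proved by any of this.

References: [GreenbergLNM1716] §2 Props. 2.2, 2.5 (pp. 73–80), §3 Lemma 3.4 (p. 89); [MilneADT2006] I Thm. 2.8, Cor. 2.3;
[SerreLocalFields1979] XIII §1.
-/

noncomputable section

open scoped Classical NNReal

namespace Summit.BirchSwinnertonDyer.BirchSwinnertonDyer.Theorems.InputsGreenbergLemma34

open CategoryTheory NumberField IsDedekindDomain Field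
  Literature.NumberTheory.GaloisRepresentations Literature.NumberTheory.GaloisRepresentations.DiscreteGaloisModule
  IsDedekindDomain.HeightOneSpectrum Literature.NumberTheory.EllipticCurves.FormalGroupChart
  _root_.TopRep _root_.ContRepresentation _root_.ContinuousCohomology WeierstrassCurve
  Summit.BirchSwinnertonDyer.BirchSwinnertonDyer.Theorems.GoodOrdTower
open Literature.NumberTheory.EllipticCurves hiding subgroupIncl

variable {p : ℕ} [hp : Fact p.Prime] {κ : ZpExtension ℚ p}

/-- `#(𝒪[ℚ_v] ⧸ m) = #(ℤ_v ⧸ m)` for `m : ℕ`, the two valuation rings having the same elements (copy of the private helper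
of `…GoodOrdTowerControlLayerFormalP`). [folklore] -/
private theorem natCard_integer_quotient_natCast_eq₃ (v : HeightOneSpectrum (𝓞 ℚ)) (m : ℕ) :
    Nat.card ((ValuativeRel.valuation (v.adicCompletion ℚ)).integer ⧸
        Ideal.span {((m : ℕ) : (ValuativeRel.valuation (v.adicCompletion ℚ)).integer)}) =
      Nat.card (Valued.integer (v.adicCompletion ℚ) ⧸
        Ideal.span {((m : ℕ) : Valued.integer (v.adicCompletion ℚ))}) := by
  have hO : (ValuativeRel.valuation (v.adicCompletion ℚ)).integer = Valued.integer (v.adicCompletion ℚ) := by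
    ext x
    rw [Valuation.mem_integer_iff, adicCompletion_valuation_le_one_iff ℚ v x,
      Valuation.mem_integer_iff, Valued.toNormedField.norm_le_one_iff]
  let e : (ValuativeRel.valuation (v.adicCompletion ℚ)).integer ≃+* Valued.integer (v.adicCompletion ℚ) :=
    RingEquiv.subringCongr hO
  have hIJ : Ideal.span {((m : ℕ) : Valued.integer (v.adicCompletion ℚ))} =
      (Ideal.span {((m : ℕ) : (ValuativeRel.valuation (v.adicCompletion ℚ)).integer)}).map
        (e : (ValuativeRel.valuation (v.adicCompletion ℚ)).integer →+* _) := by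
    rw [Ideal.map_span, Set.image_singleton, map_natCast]
  exact Nat.card_congr (Ideal.quotientEquiv _ _ e hIJ).toEquiv

set_option maxHeartbeats 3200000 in
/-- **The EXACT formal-group count at the layer `0`: `#(M₁/D₁M₁)[p^k] = #{c ∈ Ê[p^k] : τ c = c}`.** Setting (the
bsd-2adic bricks at `n = 0`): `κ` the cyclotomic `ℤ_p`-extension of `ℚ`, `v ∣ p`, `K = ℚ_v`, `w` the spectral valuation
on `K̄_v`, `W/ℚ` with `W ⊗ K̄_v` integral and elliptic, `red₀ : E(K̄_v) → B` additive with kernel the formal group `E₁`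
of `w` (`hker`), `Γ`-stable (`hstab`) and `p`-divisible (`hdiv₁`), ordinary filtration (`hgenr`, `hsurj`), `τ ∈ H_∞`
fixing every `p`-power root of unity with the Hensel property (`hHensel`), a local `ℤ_p`-extension `κE` with
`ker κE = H_∞` and `κE g = 1`, `M₁ = E₁ ∩ E(K̄_v)^{H_∞}`, `D₁ = g − 1`, the Coates–Greenberg vanishing in cocycle form
(`hCG`), and `C = E₁ ∩ E(K̄_v)[p^k]`. Then `(M₁/D₁M₁)[p^k]` is finite and `#(M₁/D₁M₁)[p^k] = #{c ∈ C : τ c = c}`. See the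
module docstring for the chain. [cite: GreenbergLNM1716, §2 Prop. 2.5 (p. 80), §3 Lemma 3.4 (p. 89)]
[cite: MilneADT2006, I Thm. 2.8, Cor. 2.3] -/
theorem natCard_torsionBy_coinv_formal_eq (hκ : κ.IsCyclotomic) (v : HeightOneSpectrum (𝓞 ℚ))
    (hv : ((p : ℕ) : 𝓞 ℚ) ∈ v.asIdeal)
    (W : WeierstrassCurve ℚ) [W.IsElliptic] (k : ℕ)
    {w : Valuation (AlgebraicClosure (v.adicCompletion ℚ)) ℝ≥0}
    (hw : ∀ x, (w x : ℝ) = spectralNorm (v.adicCompletion ℚ) (AlgebraicClosure (v.adicCompletion ℚ)) x)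
    [hV : (W.baseChange (AlgebraicClosure (v.adicCompletion ℚ))).IsIntegral w.integer]
    [(W.baseChange (AlgebraicClosure (v.adicCompletion ℚ))).IsElliptic]
    [hVL : (W.baseChange (IntermediateField.fixedField
        (localSubgroup (κ.layerSubgroup 0) (v.adicCompletion ℚ)) :
          IntermediateField (v.adicCompletion ℚ) (AlgebraicClosure (v.adicCompletion ℚ)))).IsIntegral
      (w.comap (algebraMap (IntermediateField.fixedField
        (localSubgroup (κ.layerSubgroup 0) (v.adicCompletion ℚ)) :
          IntermediateField (v.adicCompletion ℚ) (AlgebraicClosure (v.adicCompletion ℚ)))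
        (AlgebraicClosure (v.adicCompletion ℚ)))).integer]
    {B : Type} [AddCommGroup B] (red₀ : localPoints W (v.adicCompletion ℚ) →+ B)
    (hker : ∀ Q : localPoints W (v.adicCompletion ℚ), red₀ Q = 0 ↔
      (Q : (W.baseChange (AlgebraicClosure (v.adicCompletion ℚ))).toAffine.Point) ∈
        kernel w (W.baseChange (AlgebraicClosure (v.adicCompletion ℚ))))
    (hstab : ∀ (σ : absoluteGaloisGroup (v.adicCompletion ℚ)) (Q : localPoints W (v.adicCompletion ℚ)),
      red₀ Q = 0 → red₀ (σ • Q) = 0)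
    (hdiv₁ : ∀ a : localPoints W (v.adicCompletion ℚ), red₀ a = 0 →
      ∃ b : localPoints W (v.adicCompletion ℚ), red₀ b = 0 ∧ p • b = a)
    (hgenr : ∀ r : ℕ, ∃ P₁ : localPoints W (v.adicCompletion ℚ), red₀ P₁ = 0 ∧ addOrderOf P₁ = p ^ r ∧
      ∀ P : localPoints W (v.adicCompletion ℚ), red₀ P = 0 → ((p ^ r : ℕ) : ℤ) • P = 0 → ∃ c : ℕ, P = c • P₁)
    (hsurj : ∀ (r : ℕ) (y : B), ((p ^ r : ℕ) : ℤ) • y = 0 →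
      ∃ x : localPoints W (v.adicCompletion ℚ), ((p ^ r : ℕ) : ℤ) • x = 0 ∧ red₀ x = y)
    {τ : absoluteGaloisGroup (v.adicCompletion ℚ)}
    (hτfix : ∀ (r : ℕ) (ξ : AlgebraicClosure (v.adicCompletion ℚ)), ξ ^ p ^ r = 1 → τ • ξ = ξ)
    (hHensel : ∀ Q : localPoints W (v.adicCompletion ℚ), red₀ (τ • Q) = red₀ Q →
      ∃ P₀ : localPoints W (v.adicCompletion ℚ),
        (∀ σ : absoluteGaloisGroup (v.adicCompletion ℚ), σ • P₀ = P₀) ∧ red₀ P₀ = red₀ Q)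
    (κE : ZpExtension (v.adicCompletion ℚ) p)
    (hkerE : κE.kerSubgroup = localSubgroup κ.kerSubgroup (v.adicCompletion ℚ))
    {g : absoluteGaloisGroup (v.adicCompletion ℚ)} (hγ : κE.IsTopGenerator g)
    (M₁ : AddSubgroup (localPoints W (v.adicCompletion ℚ)))
    (hM₁ : ∀ a, a ∈ M₁ ↔ a ∈ red₀.ker ∧ ∀ h ∈ localSubgroup κ.kerSubgroup (v.adicCompletion ℚ), h • a = a)
    (D₁ : M₁ →+ M₁) (hD₁ : ∀ a : M₁, ((D₁ a : M₁) : localPoints W (v.adicCompletion ℚ)) = g • (a : _) - a)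
    (hCG : ∀ ψ : contOneCocycles (discreteTopRep κE.kerSubgroup (localPoints W (v.adicCompletion ℚ))),
      (∀ τ', red₀ (ψ.1 τ') = 0) →
        ∃ e : localPoints W (v.adicCompletion ℚ), red₀ e = 0 ∧
          ∀ τ' : κE.kerSubgroup, ψ.1 τ' = (τ' : absoluteGaloisGroup (v.adicCompletion ℚ)) • e - e)
    (C : AddSubgroup (localPoints W (v.adicCompletion ℚ))) (hC : ∀ a, a ∈ C ↔ red₀ a = 0 ∧ p ^ k • a = 0) :
    Finite {c : M₁ ⧸ D₁.range // p ^ k • c = 0} ∧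
      Nat.card {c : M₁ ⧸ D₁.range // p ^ k • c = 0} =
        Nat.card {c : C // τ • (c : localPoints W (v.adicCompletion ℚ)) = c} := by
  -- adapted from Summits/.../Theorems/ByReductionTypeAtTwoGoodOrdTowerControlLayerFormalP.lean (cell bsd-2adic, n = 0)
  -- notation
  let K := v.adicCompletion ℚ
  let P : Type := localPoints W K
  let Γ := absoluteGaloisGroup K
  let Hn : Subgroup Γ := localSubgroup (κ.layerSubgroup 0) K
  let Hi : Subgroup Γ := localSubgroup κ.kerSubgroup K
  haveI : CompactSpace Γ := absoluteGaloisGroup_compactSpace K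
  -- NB: `CharZero ℚ_v` is never a local instance here (`Algebra ℚ ℚ_v` diamond): it is passed explicitly below
  have hkst : ∀ (σ : Γ) (a : P), a ∈ red₀.ker → σ • a ∈ red₀.ker :=
    fun σ a ha ↦ (AddMonoidHom.mem_ker).mpr (hstab σ a ((AddMonoidHom.mem_ker).mp ha))
  have hmemHn : ∀ σ : Γ, σ ∈ Hn := fun σ ↦ by
    change σ ∈ localSubgroup (κ.layerSubgroup 0) K
    rw [mem_localSubgroup_iff, ZpExtension.layerSubgroup_zero]; exact Subgroup.mem_top _
  -- `A₀ = A₁ ∩ E(K̄_v)^{Γ}` (as `A₁ ∩ E(K̄_v)^{H_0}`)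
  let A₀ : AddSubgroup P := red₀.ker ⊓ FixedPoints.addSubgroup Hn P
  have hA₀n : ∀ a, a ∈ A₀ ↔ a ∈ red₀.ker ∧ ∀ σ ∈ Hn, σ • a = a := fun a ↦ by
    change a ∈ red₀.ker ⊓ FixedPoints.addSubgroup Hn P ↔ _
    rw [AddSubgroup.mem_inf, FixedPoints.mem_addSubgroup]
    exact ⟨fun ⟨h1, h2⟩ ↦ ⟨h1, fun σ hσ ↦ h2 ⟨σ, hσ⟩⟩, fun ⟨h1, h2⟩ ↦ ⟨h1, fun σ ↦ h2 σ σ.2⟩⟩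
  have hA₀ : ∀ a, a ∈ A₀ ↔ a ∈ red₀.ker ∧ ∀ σ : Γ, σ • a = a := fun a ↦ by
    rw [hA₀n]
    exact ⟨fun ⟨h1, h2⟩ ↦ ⟨h1, fun σ ↦ h2 σ (hmemHn σ)⟩, fun ⟨h1, h2⟩ ↦ ⟨h1, fun σ _ ↦ h2 σ⟩⟩
  -- iterated `p`-divisibility of `A₁`
  have hdivpow : ∀ (j : ℕ) (a : P), a ∈ red₀.ker → ∃ b ∈ red₀.ker, p ^ j • b = a := by
    intro j
    induction j with
    | zero => exact fun a ha ↦ ⟨a, ha, by rw [pow_zero, one_smul]⟩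
    | succ j ih =>
      intro a ha
      obtain ⟨b, hb, rfl⟩ := hdiv₁ a ((AddMonoidHom.mem_ker).mp ha)
      obtain ⟨c, hc, rfl⟩ := ih b ((AddMonoidHom.mem_ker).mpr hb)
      exact ⟨c, hc, by rw [pow_succ, mul_comm, mul_smul]⟩
  -- the torsion module `Z = C = A₁[p^k]`, cyclic on `P_k`, with its Galois representation
  obtain ⟨Pk, hPk0, hPkord, hPkgen⟩ := hgenr k
  have hPk2 : p ^ k • Pk = 0 := by rw [← hPkord]; exact addOrderOf_nsmul_eq_zero Pk
  have hZs : ∀ a : P, a ∈ C ↔ red₀ a = 0 ∧ p ^ k • a = 0 := hC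
  have hPkZ : Pk ∈ C := (hZs Pk).mpr ⟨hPk0, hPk2⟩
  have hZmul : ∀ a ∈ C, ∃ c : ℕ, a = c • Pk := fun a ha ↦
    hPkgen a ((hZs a).mp ha).1 (by rw [natCast_zsmul]; exact ((hZs a).mp ha).2)
  have hZstab : ∀ (σ : Γ) (a : P), a ∈ C → σ • a ∈ C := fun σ a ha ↦
    (hZs _).mpr ⟨hstab σ a ((hZs a).mp ha).1, by rw [smul_comm, ((hZs a).mp ha).2, smul_zero]⟩
  letI iSMul : SMul Γ C := ⟨fun σ z ↦ ⟨σ • (z : P), hZstab σ z z.2⟩⟩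
  have hsmul : ∀ (σ : Γ) (z : C), ((σ • z : C) : P) = σ • (z : P) := fun _ _ ↦ rfl
  letI iMA : MulAction Γ C :=
    { one_smul := fun z ↦ Subtype.ext (by rw [hsmul, one_smul])
      mul_smul := fun σ σ' z ↦ Subtype.ext (by rw [hsmul, hsmul, hsmul, mul_smul]) }
  letI iDMA : DistribMulAction Γ C :=
    { smul_zero := fun σ ↦ Subtype.ext (by rw [hsmul, ZeroMemClass.coe_zero, smul_zero])
      smul_add := fun σ z z' ↦ Subtype.ext (by
        rw [hsmul, AddMemClass.coe_add, AddMemClass.coe_add, hsmul, hsmul, smul_add]) }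
  let ρC : ContinuousRep Γ ℤ C :=
    ContinuousRep.ofStabilizerMemNhdsOne (Representation.ofDistribMulAction ℤ Γ C) fun z ↦ by
      have hopen' : IsOpen ((fun σ : Γ ↦ σ • (z : P)) ⁻¹' {(z : P)}) :=
        (isOpen_discrete _).preimage (continuous_smul_localPoints W K (z : P))
      refine Filter.mem_of_superset (hopen'.mem_nhds (by simp)) fun σ hσ ↦ ?_
      exact Subtype.ext hσ
  have hρC : ∀ (σ : Γ) (z : C), ((ρC σ z : C) : P) = σ • (z : P) := fun _ _ ↦ rfl
  let Pz : C := ⟨Pk, hPkZ⟩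
  have hZgen : ∀ z : C, ∃ i : ℕ, z = i • Pz := fun z ↦ by
    obtain ⟨c, hc⟩ := hZmul z z.2
    exact ⟨c, Subtype.ext (by rw [AddSubmonoidClass.coe_nsmul]; exact hc)⟩
  have hPzord : addOrderOf Pz = p ^ k := by rw [← AddSubgroup.addOrderOf_coe Pz]; exact hPkord
  have hZcard : Nat.card C = p ^ k := by
    have h : (AddSubgroup.zmultiples Pz : AddSubgroup C) = ⊤ := by
      rw [eq_top_iff]
      intro z _
      obtain ⟨i, hi⟩ := hZgen z
      exact hi ▸ AddSubgroup.nsmul_mem _ (AddSubgroup.mem_zmultiples Pz) i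
    rw [← hPzord, ← Nat.card_zmultiples Pz, h, AddSubgroup.card_top]
  haveI hZfin : Finite C := Nat.finite_of_card_ne_zero (by rw [hZcard]; exact pow_ne_zero k hp.out.ne_zero)
  -- (A) the exact Kummer count: `#(M₁/D₁M₁)[p^k] · #(A₀/p^k A₀) = #H¹(Γ, Z)` (discrete `H¹`)
  have hM₁' : ∀ a, a ∈ M₁ ↔ a ∈ red₀.ker ∧ ∀ h ∈ κE.kerSubgroup, h • a = a := fun a ↦ by
    rw [hM₁, hkerE]
  have hZr : ∀ a : P, a ∈ red₀.ker ∧ p ^ k • a = 0 ↔ a ∈ C.subtype.range := fun a ↦ by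
    rw [AddSubgroup.range_subtype, hZs, AddMonoidHom.mem_ker]
  have hCG' : ∀ ψ : contOneCocycles (discreteTopRep κE.kerSubgroup P), (∀ τ', ψ.1 τ' ∈ red₀.ker) →
      ∃ e ∈ red₀.ker, ∀ τ' : κE.kerSubgroup, ψ.1 τ' = (τ' : Γ) • e - e := by
    intro ψ hψ
    obtain ⟨e, he0, he⟩ := hCG ψ (fun τ' ↦ (AddMonoidHom.mem_ker).mp (hψ τ'))
    exact ⟨e, (AddMonoidHom.mem_ker).mpr he0, he⟩
  let X₁ : TopRep ℤ Γ := discreteTopRep Γ C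
  let X₂ : TopRep ℤ Γ := ρC.toTopRep
  let eΓ : Γ ≃ₜ* Γ := ContinuousMulEquiv.refl Γ
  let φ : TopRep.res ((eΓ.symm : Γ →ₜ* Γ) : Γ →* Γ) X₁ ⟶ X₂ := TopRep.ofHom ⟨ContinuousLinearMap.id ℤ C, fun _ ↦ rfl⟩
  let ψ : TopRep.res ((eΓ : Γ →ₜ* Γ) : Γ →* Γ) X₂ ⟶ X₁ := TopRep.ofHom ⟨ContinuousLinearMap.id ℤ C, fun _ ↦ rfl⟩
  have htr : Nat.card (discreteH1 Γ C) = Nat.card (continuousCohomology 1 X₂) :=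
    natCard_continuousCohomology_eq_of_continuousMulEquiv eΓ φ ψ (fun _ ↦ rfl) (fun _ ↦ rfl) 1
  -- Tate's local Euler–Poincaré formula for `Z` (PROVED in the tree)
  obtain ⟨hf1, hf2, hEPZ⟩ : Finite (continuousCohomology 1 ρC.toTopRep) ∧ Finite (continuousCohomology 2 ρC.toTopRep) ∧
      Nat.card ρC.toTopRep.ρ.invariants * Nat.card (continuousCohomology 2 ρC.toTopRep) *
          Nat.card ((ValuativeRel.valuation K).integer ⧸
            Ideal.span {((Nat.card C : ℕ) : (ValuativeRel.valuation K).integer)}) =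
        Nat.card (continuousCohomology 1 ρC.toTopRep) := by
    exact @Summit.BirchSwinnertonDyer.Rank1Residual.GaloisImage.localEulerPoincare K _ _ _ _
      (charZero_of_injective_algebraMap (algebraMap ℚ K).injective) C _ _ _ _ ρC
  haveI := hf1
  haveI := hf2
  haveI : Finite (discreteH1 Γ C) := finite_continuousCohomology_of_continuousMulEquiv eΓ φ ψ (fun _ ↦ rfl) 1
  obtain ⟨hfinT, hfinQ, hKum⟩ : Finite {c : M₁ ⧸ D₁.range // p ^ k • c = 0} ∧
      Finite (A₀ ⧸ (nsmulAddMonoidHom (p ^ k) : A₀ →+ A₀).range) ∧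
      Nat.card {c : M₁ ⧸ D₁.range // p ^ k • c = 0} *
          Nat.card (A₀ ⧸ (nsmulAddMonoidHom (p ^ k) : A₀ →+ A₀).range) = Nat.card (discreteH1 Γ C) := by
    exact @natCard_torsionBy_coinv_mul_card_quotient_eq_card_H1 ℚ _ W K _
      (charZero_of_injective_algebraMap (algebraMap ℚ K).injective) _ p _ κE g hγ k red₀.ker hkst
      (hdivpow k) C _ _ _ _ C.subtype Subtype.val_injective hZr (fun _ _ ↦ rfl) M₁ hM₁' D₁ hD₁ A₀ hA₀ hCG' _
  refine ⟨hfinT, ?_⟩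
  -- `#(𝒪[ℚ_v] ⧸ #Z) = p^k`
  rw [hZcard] at hEPZ
  have hOm : Nat.card ((ValuativeRel.valuation K).integer ⧸
      Ideal.span {((p ^ k : ℕ) : (ValuativeRel.valuation K).integer)}) = p ^ k := by
    rw [natCard_integer_quotient_natCast_eq₃ v (p ^ k)]
    have hT : ∀ v' : HeightOneSpectrum (𝓞 ℚ), ((p ^ k : ℕ) : 𝓞 ℚ) ∈ v'.asIdeal → v' ∈ ({v} : Finset _) := by
      intro v' hv'
      rw [Finset.mem_singleton]
      have hv'p : ((p : ℕ) : 𝓞 ℚ) ∈ v'.asIdeal := by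
        rw [Nat.cast_pow] at hv'
        exact v'.isPrime.mem_of_pow_mem _ hv'
      apply (Rat.HeightOneSpectrum.primesEquiv (R := 𝓞 ℚ)).injective
      exact Subtype.ext ((Rat.HeightOneSpectrum.primesEquiv_eq_of_natCast_mem v' hp.out hv'p).trans
        (Rat.HeightOneSpectrum.primesEquiv_eq_of_natCast_mem v hp.out hv).symm)
    have h := prod_natCard_integer_quotient_natCast (K := ℚ) (pow_ne_zero k hp.out.ne_zero) hT
    rw [Finset.prod_singleton, Module.finrank_self, pow_one] at h
    exact h
  rw [hOm] at hEPZ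
  -- (B) the exact `H²` count
  have hH2 : Nat.card (continuousCohomology 2 ρC.toTopRep) = Nat.card {c : C // τ • (c : P) = c} := by
    exact (@natCard_H2_formalTorsion_eq_natCard_fixed ℚ _ W _ K _ _ _ _
      (charZero_of_injective_algebraMap (algebraMap ℚ K).injective) _ p _ B _ red₀ hstab hgenr hsurj τ hτfix
      hHensel k C hC ρC hρC).2
  -- (C) invariants of `Z` over `Γ` = `A₀[p^k]`
  have hinv : Nat.card ρC.toTopRep.ρ.invariants = Nat.card (nsmulAddMonoidHom (p ^ k) : A₀ →+ A₀).ker := by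
    refine Nat.card_congr ?_
    exact
      { toFun := fun z ↦ ⟨⟨((z.1 : C) : P), (hA₀ _).mpr ⟨(AddMonoidHom.mem_ker).mpr ((hZs _).mp z.1.2).1,
            fun σ ↦ by
              have h := z.2 σ
              exact (congrArg (fun y : C ↦ (y : P)) h : _)⟩⟩,
          by
            rw [AddMonoidHom.mem_ker, nsmulAddMonoidHom_apply]
            exact Subtype.ext (by rw [AddSubmonoidClass.coe_nsmul, ZeroMemClass.coe_zero]; exact ((hZs _).mp z.1.2).2)⟩
        invFun := fun a ↦ ⟨⟨((a.1 : A₀) : P), (hZs _).mpr ⟨(AddMonoidHom.mem_ker).mp ((hA₀ _).mp a.1.2).1, by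
            have h := a.2
            rw [AddMonoidHom.mem_ker, nsmulAddMonoidHom_apply] at h
            have h' := congrArg (fun y : A₀ ↦ (y : P)) h
            simpa only [AddSubmonoidClass.coe_nsmul, ZeroMemClass.coe_zero] using h'⟩⟩,
          fun σ ↦ Subtype.ext (((hA₀ _).mp a.1.2).2 σ)⟩
        left_inv := fun z ↦ Subtype.ext (Subtype.ext rfl)
        right_inv := fun a ↦ Subtype.ext (Subtype.ext rfl) }
  -- (D) Lutz at depth `p^k` for `A₀`
  haveI := MultTowerNS2.finiteDimensional_fixedField_localSubgroup_layerSubgroup (κ := κ) v 0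
  have hfr := MultTowerNS2.finrank_fixedField_localSubgroup_layerSubgroup hκ v hv 0
  have hAH : ∀ Q : P, Q ∈ A₀ ↔ (Q : (W.baseChange (AlgebraicClosure K)).toAffine.Point) ∈
      kernel w (W.baseChange (AlgebraicClosure K)) ∧ ∀ σ ∈ Hn, σ • Q = Q := fun Q ↦ by
    rw [hA₀n, AddMonoidHom.mem_ker, hker Q]
  obtain ⟨hfinq, hfinker, hLutz⟩ := natCard_quotient_nsmul_fixedKernel_eq (K := ℚ) (v := v) hw hv W Hn A₀ hAH
  haveI := hfinq
  have hO2 : Nat.card (v.adicCompletionIntegers ℚ ⧸ Ideal.span {((p : ℕ) : v.adicCompletionIntegers ℚ)}) = p := by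
    have hϖ : Irreducible ((p : ℕ) : v.adicCompletionIntegers ℚ) := irreducible_natCast_adicCompletionIntegers_rat hv
    rw [← (IsDiscreteValuationRing.irreducible_iff_uniformizer _).mp hϖ]
    change Nat.card (IsLocalRing.ResidueField (v.adicCompletionIntegers ℚ)) = p
    rw [natCard_residueField_adicCompletionIntegers v, Rat.HeightOneSpectrum.primesEquiv_eq_of_natCast_mem v hp.out hv]
  have hfinj : ∀ j : ℕ, Finite (nsmulAddMonoidHom (p ^ j) : A₀ →+ A₀).ker := by
    intro j
    obtain ⟨Pj, hPj0, hPjord, hPjgen⟩ := hgenr j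
    haveI : Finite (AddSubgroup.zmultiples Pj) := Nat.finite_of_card_ne_zero (by
      rw [Nat.card_zmultiples, hPjord]; exact pow_ne_zero j hp.out.ne_zero)
    refine Finite.of_injective (fun a : (nsmulAddMonoidHom (p ^ j) : A₀ →+ A₀).ker ↦
      (⟨((a : A₀) : P), ?_⟩ : AddSubgroup.zmultiples Pj)) fun a b hab ↦ ?_
    · have ha := a.2
      rw [AddMonoidHom.mem_ker, nsmulAddMonoidHom_apply] at ha
      have ha' : p ^ j • ((a : A₀) : P) = 0 := by
        have h := congrArg (fun y : A₀ ↦ (y : P)) ha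
        simpa only [AddSubmonoidClass.coe_nsmul, ZeroMemClass.coe_zero] using h
      obtain ⟨c, hc⟩ := hPjgen _ ((AddMonoidHom.mem_ker).mp ((hA₀ _).mp (a : A₀).2).1)
        (by rw [natCast_zsmul]; exact ha')
      rw [hc]
      exact AddSubgroup.nsmul_mem _ (AddSubgroup.mem_zmultiples Pj) c
    · exact Subtype.ext (Subtype.ext (congrArg (fun y : AddSubgroup.zmultiples Pj ↦ (y : P)) hab))
  obtain ⟨-, hE⟩ := natCard_quotient_nsmul_pow_eq (A := A₀) p _ hfinj hLutz k
  rw [hO2, hfr] at hE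
  -- (E) combine: `#(M₁/D₁M₁)[p^k] · (p^k · #A₀[p^k]) = #A₀[p^k] · #C^τ · p^k`
  rw [hinv, hH2] at hEPZ
  rw [htr] at hKum
  haveI := hfinker
  haveI := hfinj k
  have hX : 0 < (p ^ p ^ 0) ^ k * Nat.card (nsmulAddMonoidHom (p ^ k) : A₀ →+ A₀).ker :=
    Nat.mul_pos (pow_pos (pow_pos hp.out.pos _) _) Nat.card_pos
  refine Nat.eq_of_mul_eq_mul_right hX ?_
  calc Nat.card {c : M₁ ⧸ D₁.range // p ^ k • c = 0} *
        ((p ^ p ^ 0) ^ k * Nat.card (nsmulAddMonoidHom (p ^ k) : A₀ →+ A₀).ker)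
      = Nat.card {c : M₁ ⧸ D₁.range // p ^ k • c = 0} *
          Nat.card (A₀ ⧸ (nsmulAddMonoidHom (p ^ k) : A₀ →+ A₀).range) := by rw [hE]
    _ = Nat.card (continuousCohomology 1 X₂) := hKum
    _ = Nat.card (nsmulAddMonoidHom (p ^ k) : A₀ →+ A₀).ker *
          Nat.card {c : C // τ • (c : P) = c} * p ^ k := hEPZ.symm
    _ = Nat.card {c : C // τ • (c : P) = c} *
          ((p ^ p ^ 0) ^ k * Nat.card (nsmulAddMonoidHom (p ^ k) : A₀ →+ A₀).ker) := by
        rw [pow_zero, pow_one]; ring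

end Summit.BirchSwinnertonDyer.BirchSwinnertonDyer.Theorems.InputsGreenbergLemma34

end
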